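import Literature.AnabelianGeometry.EtaleTheta.FrobenioidThetaDivisorSupportR

/-!
# [EtTh] §5, Proposition 5.3: orders, supports and degrees over the repaired divisor-support data (toolkit)

Mochizuki, *The étale theta function …*, Publ. RIMS **45** (2009)
[cite: MochizukiEtTh2009, Prop 5.3 proof p.326–327 (PDF pp.100–101); §1 p.240 (PDF p.14)].
Seat abc-iut-L6-d1 (gen 3); proof-only toolkit over `FrobenioidThetaDivisorSupportR.lean` (this seat) for the
GAP-LEDGER row G-L2d4-2 companions `FrobenioidThetaDivisorSupportIntersection.lean` /
`FrobenioidThetaDivisorSupportAdjacency.lean`: the additive (`ℚ`-valued) order `ord`, its values on primary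
elements and prime log-divisors, supports, the decomposition of the degree `degOn` into its vertical part
`ord_{𝔫⁻} x − 2·ord_𝔫 x + ord_{𝔫⁺} x` and its cusp sum `Σ_{𝔠 ↦ 𝔫} ord_𝔠 x` (a `finsum` over the fibre TYPE
`{𝔠 // cspToNcsp 𝔠 = 𝔫}`) with their additivity on elements of finite support, and the compatibility of the
"natural isomorphisms between primary components" with the orders (DERIVED: `Φ(A_⊚)_𝔭` is the set of powers
of `gen 𝔭`, so a monoid isomorphism `Φ(A_⊚)_𝔭 ⥲ Φ(A_⊚)_𝔮` maps `gen 𝔭 ↦ gen 𝔮` — "the multiplicities … are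
equal", p.326).  No definitions (proof-only).  (abc-iut-L2-d4's parallel port
`Discharge/Sec5Prop53LabelsR.lean` carries one-directional twins `eq_gen_pow_of_mem_carrier` /
`gen_pow_mem_carrier` / `submonoid_eq_powers'`; the `iff` forms below are self-contained so that this toolkit
depends on the repaired data file only.)
HONEST FRAMING: typed ≠ proved; nothing here concerns an actual curve; no side taken on anything downstream. -/

namespace Literature.AnabelianGeometry.EtaleTheta

open CategoryTheory
open Literature.AlgebraicGeometry.Frobenioids

universe w v v' u u'

namespace FrobenioidThetaDivisors

namespace DivisorSupportData'

variable {C : Type u} [Category.{v} C] {D : Type u'} [Category.{v'} D] {𝔉 : ThetaFrobenioid.{w} C D}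
variable {𝔓 : DivisorPrimeData 𝔉} (𝔖 : DivisorSupportData' 𝔓)

open scoped Classical

/-! ### The additive order -/

/-- `ord` is additive. [cite: MochizukiEtTh2009, Prop 5.3 proof p.326 (PDF p.100)] -/
theorem ord_mul (𝔭 : Primes 𝔉.PhiAcirc) (x y : Algebra.GrothendieckGroup 𝔉.PhiAcirc) :
    𝔖.ord 𝔭 (x * y) = 𝔖.ord 𝔭 x + 𝔖.ord 𝔭 y := by
  simp only [ord, map_mul, toAdd_mul]

/-- `ord` of an inverse. [cite: MochizukiEtTh2009, Prop 5.3 proof p.326 (PDF p.100)] -/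
theorem ord_inv (𝔭 : Primes 𝔉.PhiAcirc) (x : Algebra.GrothendieckGroup 𝔉.PhiAcirc) :
    𝔖.ord 𝔭 x⁻¹ = -𝔖.ord 𝔭 x := by
  simp only [ord, map_inv, toAdd_inv]

/-- `ord` of `1`. [cite: MochizukiEtTh2009, Prop 5.3 proof p.326 (PDF p.100)] -/
theorem ord_one (𝔭 : Primes 𝔉.PhiAcirc) : 𝔖.ord 𝔭 1 = 0 := by
  simp only [ord, map_one, toAdd_one]

/-- `ord` of a power. [cite: MochizukiEtTh2009, Prop 5.3 proof p.326 (PDF p.100)] -/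
theorem ord_pow (𝔭 : Primes 𝔉.PhiAcirc) (x : Algebra.GrothendieckGroup 𝔉.PhiAcirc) (n : ℕ) :
    𝔖.ord 𝔭 (x ^ n) = n * 𝔖.ord 𝔭 x := by
  simp only [ord, map_pow, toAdd_pow, nsmul_eq_mul]

/-- `ord` of an integer power. [cite: MochizukiEtTh2009, Prop 5.3 proof p.326 (PDF p.100)] -/
theorem ord_zpow (𝔭 : Primes 𝔉.PhiAcirc) (x : Algebra.GrothendieckGroup 𝔉.PhiAcirc) (n : ℤ) :
    𝔖.ord 𝔭 (x ^ n) = n * 𝔖.ord 𝔭 x := by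
  simp only [ord, map_zpow, toAdd_zpow, zsmul_eq_mul]

/-- `ord` on the image of `Φ(A_⊚)` is the F2-coordinate.
[cite: MochizukiEtTh2009, Prop 5.3 proof p.326 (PDF p.100)] -/
theorem ord_of (𝔭 : Primes 𝔉.PhiAcirc) (a : 𝔉.PhiAcirc) :
    𝔖.ord 𝔭 (Algebra.GrothendieckGroup.of a) = Multiplicative.toAdd (𝔖.factor a 𝔭) := by
  have h := Algebra.GrothendieckGroup.lift.symm_apply_apply (ordOf' 𝔖.factor 𝔭)
  rw [Algebra.GrothendieckGroup.lift_symm_apply] at h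
  have h' := DFunLike.congr_fun h a
  simp only [MonoidHom.coe_comp, Function.comp_apply] at h'
  change Multiplicative.toAdd
    (Algebra.GrothendieckGroup.lift (ordOf' 𝔖.factor 𝔭) (Algebra.GrothendieckGroup.of a)) = _
  rw [h']
  rfl

/-- Coordinates of elements of `Φ(A_⊚)` are non-negative.
[cite: MochizukiEtTh2009, Prop 5.3 proof p.326 (PDF p.100)] -/
theorem ord_of_nonneg (𝔭 : Primes 𝔉.PhiAcirc) (a : 𝔉.PhiAcirc) :
    0 ≤ 𝔖.ord 𝔭 (Algebra.GrothendieckGroup.of a) := by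
  rw [ord_of]; exact 𝔖.factor_nonneg a 𝔭

/-- The prime log-divisor `gen 𝔭` has order `1` at `𝔭`. [cite: MochizukiEtTh2009, Prop 5.3 p.325 (PDF p.99)] -/
theorem ord_gen_self (𝔭 : Primes 𝔉.PhiAcirc) :
    𝔖.ord 𝔭 (Algebra.GrothendieckGroup.of (𝔖.gen 𝔭)) = 1 := by
  rw [ord_of, 𝔖.factor_gen_self, toAdd_ofAdd]

/-- The prime log-divisor `gen 𝔭` has order `0` elsewhere. [cite: MochizukiEtTh2009, Prop 5.3 p.325 (PDF p.99)] -/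
theorem ord_gen_of_ne {𝔭 𝔮 : Primes 𝔉.PhiAcirc} (h : 𝔮 ≠ 𝔭) :
    𝔖.ord 𝔮 (Algebra.GrothendieckGroup.of (𝔖.gen 𝔭)) = 0 := by
  rw [ord_of, 𝔖.factor_gen_of_ne h, toAdd_one]

/-- Order of `gen 𝔭` at `𝔮`, as an indicator. [cite: MochizukiEtTh2009, Prop 5.3 p.325 (PDF p.99)] -/
theorem ord_gen (𝔭 𝔮 : Primes 𝔉.PhiAcirc) :
    𝔖.ord 𝔮 (Algebra.GrothendieckGroup.of (𝔖.gen 𝔭)) = if 𝔮 = 𝔭 then 1 else 0 := by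
  split_ifs with h
  · rw [h, ord_gen_self]
  · exact 𝔖.ord_gen_of_ne h

/-- A primary element of `𝔭` has a positive integral order at `𝔭` and order `0` elsewhere.
[cite: MochizukiEtTh2009, Prop 5.3 p.325 (PDF p.99)] -/
theorem ord_of_mem_carrier {𝔭 : Primes 𝔉.PhiAcirc} {a : 𝔉.PhiAcirc} (ha : a ∈ 𝔭.carrier) :
    ∃ n : ℕ, 0 < n ∧ 𝔖.ord 𝔭 (Algebra.GrothendieckGroup.of a) = n ∧
      ∀ 𝔮, 𝔮 ≠ 𝔭 → 𝔖.ord 𝔮 (Algebra.GrothendieckGroup.of a) = 0 := by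
  obtain ⟨n, hn, h𝔭, h𝔮⟩ := (𝔖.factor_carrier 𝔭 a).mp ha
  refine ⟨n, hn, by rw [ord_of, h𝔭, toAdd_ofAdd], fun 𝔮 h => by rw [ord_of, h𝔮 𝔮 h, toAdd_one]⟩

/-- Primary elements of `𝔭` are exactly the positive powers of `gen 𝔭`.
[cite: MochizukiEtTh2009, Prop 5.3 p.325 (PDF p.99)] -/
theorem mem_carrier_iff (𝔭 : Primes 𝔉.PhiAcirc) (a : 𝔉.PhiAcirc) :
    a ∈ 𝔭.carrier ↔ ∃ n : ℕ, 0 < n ∧ a = 𝔖.gen 𝔭 ^ n := by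
  have hpow : ∀ n : ℕ, 𝔖.factor (𝔖.gen 𝔭 ^ n) 𝔭 = Multiplicative.ofAdd (n : ℚ) := fun n => by
    rw [map_pow, Pi.pow_apply, 𝔖.factor_gen_self, ← ofAdd_nsmul, nsmul_eq_mul, mul_one]
  have hpow' : ∀ (n : ℕ) (𝔮 : Primes 𝔉.PhiAcirc), 𝔮 ≠ 𝔭 → 𝔖.factor (𝔖.gen 𝔭 ^ n) 𝔮 = 1 := fun n 𝔮 h => by
    rw [map_pow, Pi.pow_apply, 𝔖.factor_gen_of_ne h, one_pow]
  constructor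
  · intro ha
    obtain ⟨n, hn, h𝔭, h𝔮⟩ := (𝔖.factor_carrier 𝔭 a).mp ha
    refine ⟨n, hn, 𝔖.factor_injective (funext fun 𝔮 => ?_)⟩
    by_cases h : 𝔮 = 𝔭
    · subst h; rw [h𝔭, hpow]
    · rw [h𝔮 𝔮 h, hpow' n 𝔮 h]
  · rintro ⟨n, hn, rfl⟩
    exact (𝔖.factor_carrier 𝔭 _).mpr ⟨n, hn, hpow n, fun 𝔮 h => hpow' n 𝔮 h⟩

/-- The prime log-divisor `gen 𝔭` lies in the primary component `Φ(A_⊚)_𝔭`.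
[cite: MochizukiEtTh2009, Prop 5.3 p.325 (PDF p.99)] -/
theorem gen_mem_submonoid (𝔭 : Primes 𝔉.PhiAcirc) : DivisorSupportData'.gen 𝔖 𝔭 ∈ 𝔭.submonoid :=
  Submonoid.subset_closure ((𝔖.mem_carrier_iff 𝔭 _).mpr ⟨1, one_pos, (pow_one _).symm⟩)

/-- The exponent of a power of `gen 𝔭` is determined by the `𝔭`-coordinate.
[cite: MochizukiEtTh2009, Prop 5.3 p.325 (PDF p.99)] -/
theorem eq_of_gen_pow_eq (𝔭 : Primes 𝔉.PhiAcirc) {n m : ℕ} (h : 𝔖.gen 𝔭 ^ n = 𝔖.gen 𝔭 ^ m) : n = m := by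
  have h' := congrArg (fun a => Multiplicative.toAdd (𝔖.factor a 𝔭)) h
  simp only [map_pow, Pi.pow_apply, 𝔖.factor_gen_self, toAdd_pow, toAdd_ofAdd, nsmul_eq_mul, mul_one,
    Nat.cast_inj] at h'
  exact h'

/-- `Φ(A_⊚)_𝔭` (the submonoid generated by the primary elements of `𝔭`) is the set of powers of `gen 𝔭`
("`Φ(A_⊚)_𝔭 ≅ ℤ_{≥0}`", monoid type `ℤ`).
[cite: MochizukiEtTh2009, Def 3.6 (i) p.302 (PDF p.76); Prop 5.3 p.325 (PDF p.99)] -/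
theorem mem_submonoid_iff (𝔭 : Primes 𝔉.PhiAcirc) (a : 𝔉.PhiAcirc) :
    a ∈ 𝔭.submonoid ↔ ∃ n : ℕ, a = 𝔖.gen 𝔭 ^ n := by
  constructor
  · intro ha
    induction ha using Submonoid.closure_induction with
    | mem x hx => obtain ⟨n, -, rfl⟩ := (𝔖.mem_carrier_iff 𝔭 x).mp hx; exact ⟨n, rfl⟩
    | one => exact ⟨0, (pow_zero _).symm⟩
    | mul x y _ _ hx hy =>
      obtain ⟨n, rfl⟩ := hx; obtain ⟨m, rfl⟩ := hy; exact ⟨n + m, (pow_add _ _ _).symm⟩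
  · rintro ⟨n, rfl⟩
    exact pow_mem (𝔖.gen_mem_submonoid 𝔭) n

/-! ### The natural isomorphisms between primary components respect the orders (DERIVED) -/

/-- A monoid isomorphism `Φ(A_⊚)_𝔭 ⥲ Φ(A_⊚)_𝔮` maps `gen 𝔭 ↦ gen 𝔮` (both sides are free on one
generator).  [cite: MochizukiEtTh2009, Rmk 3.8.2 / Prop 5.3 (ii) p.325 (PDF p.99)] -/
theorem submonoidEquiv_gen (𝔭 𝔮 : Primes 𝔉.PhiAcirc) (e : 𝔭.submonoid ≃* 𝔮.submonoid) :
    (e ⟨𝔖.gen 𝔭, 𝔖.gen_mem_submonoid 𝔭⟩ : 𝔉.PhiAcirc) = 𝔖.gen 𝔮 := by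
  set g𝔭 : 𝔭.submonoid := ⟨𝔖.gen 𝔭, 𝔖.gen_mem_submonoid 𝔭⟩ with hg𝔭
  set g𝔮 : 𝔮.submonoid := ⟨𝔖.gen 𝔮, 𝔖.gen_mem_submonoid 𝔮⟩ with hg𝔮
  obtain ⟨l, hl⟩ := (𝔖.mem_submonoid_iff 𝔮 _).mp (e g𝔭).2
  obtain ⟨k, hk⟩ := (𝔖.mem_submonoid_iff 𝔭 _).mp (e.symm g𝔮).2
  -- `gen 𝔮 = e (e.symm (gen 𝔮)) = e (gen 𝔭 ^ k) = gen 𝔮 ^ (l * k)`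
  have hsymm : e.symm g𝔮 = g𝔭 ^ k := Subtype.ext (by rw [hk]; rfl)
  have h2 : ((e (e.symm g𝔮) : 𝔮.submonoid) : 𝔉.PhiAcirc) = (g𝔮 : 𝔉.PhiAcirc) := by
    rw [e.apply_symm_apply]
  rw [hsymm, map_pow, SubmonoidClass.coe_pow, hl, ← pow_mul] at h2
  have hlk : l * k = 1 := 𝔖.eq_of_gen_pow_eq 𝔮 (by simpa using h2)
  rw [hl, Nat.eq_one_of_mul_eq_one_right hlk, pow_one]

/-- Hence such an isomorphism maps `gen 𝔭 ^ n ↦ gen 𝔮 ^ n`: "if `a ∈ 𝔭`, `b ∈ 𝔮` correspond via the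
natural isomorphisms of (ii)" then `b` has the same multiplicity as `a`.
[cite: MochizukiEtTh2009, Prop 5.3 proof p.326 (PDF p.100)] -/
theorem submonoidEquiv_gen_pow (𝔭 𝔮 : Primes 𝔉.PhiAcirc) (e : 𝔭.submonoid ≃* 𝔮.submonoid) (n : ℕ)
    (a : 𝔭.submonoid) (ha : (a : 𝔉.PhiAcirc) = 𝔖.gen 𝔭 ^ n) :
    (e a : 𝔉.PhiAcirc) = 𝔖.gen 𝔮 ^ n := by
  have : a = ⟨𝔖.gen 𝔭, 𝔖.gen_mem_submonoid 𝔭⟩ ^ n :=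
    Subtype.ext (by rw [ha]; rfl)
  rw [this, map_pow, SubmonoidClass.coe_pow, 𝔖.submonoidEquiv_gen]

/-! ### Supports -/

/-- Membership in the support. [cite: MochizukiEtTh2009, Prop 5.3 proof p.326 (PDF p.100)] -/
theorem mem_supp_iff (𝔭 : Primes 𝔉.PhiAcirc) (x : Algebra.GrothendieckGroup 𝔉.PhiAcirc) :
    𝔭 ∈ 𝔖.supp x ↔ 𝔖.ord 𝔭 x ≠ 0 := by
  simp only [supp, suppOf', Set.mem_setOf_eq, ord, ordGp, ne_eq]
  exact ⟨fun h h' => h (by rw [← ofAdd_toAdd (ordGpOf' 𝔖.factor 𝔭 x), h', ofAdd_zero]),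
    fun h h' => h (by rw [h', toAdd_one])⟩

/-- Off the support the order vanishes. [cite: MochizukiEtTh2009, Prop 5.3 proof p.326 (PDF p.100)] -/
theorem ord_eq_zero_of_notMem_supp {𝔭 : Primes 𝔉.PhiAcirc} {x : Algebra.GrothendieckGroup 𝔉.PhiAcirc}
    (h : 𝔭 ∉ 𝔖.supp x) : 𝔖.ord 𝔭 x = 0 := by
  by_contra h'; exact h ((𝔖.mem_supp_iff 𝔭 x).mpr h')

/-- The support of a product is contained in the union of the supports.
[cite: MochizukiEtTh2009, Prop 5.3 proof p.326 (PDF p.100)] -/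
theorem supp_mul_subset (x y : Algebra.GrothendieckGroup 𝔉.PhiAcirc) :
    𝔖.supp (x * y) ⊆ 𝔖.supp x ∪ 𝔖.supp y := by
  intro 𝔭 h
  rw [𝔖.mem_supp_iff, ord_mul] at h
  by_contra h'
  rw [Set.mem_union, not_or, 𝔖.mem_supp_iff, 𝔖.mem_supp_iff, not_not, not_not] at h'
  exact h (by rw [h'.1, h'.2, add_zero])

/-- The support of an inverse. [cite: MochizukiEtTh2009, Prop 5.3 proof p.326 (PDF p.100)] -/
theorem supp_inv (x : Algebra.GrothendieckGroup 𝔉.PhiAcirc) : 𝔖.supp x⁻¹ = 𝔖.supp x := by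
  ext 𝔭; simp only [𝔖.mem_supp_iff, ord_inv, ne_eq, neg_eq_zero]

/-- The support of a primary element of `𝔭` is `{𝔭}`.
[cite: MochizukiEtTh2009, Prop 5.3 proof p.326 (PDF p.100)] -/
theorem supp_of_mem_carrier {𝔭 : Primes 𝔉.PhiAcirc} {a : 𝔉.PhiAcirc} (ha : a ∈ 𝔭.carrier) :
    𝔖.supp (Algebra.GrothendieckGroup.of a) = {𝔭} := by
  obtain ⟨n, hn, h𝔭, h𝔮⟩ := 𝔖.ord_of_mem_carrier ha
  ext 𝔮
  rw [𝔖.mem_supp_iff, Set.mem_singleton_iff]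
  by_cases h : 𝔮 = 𝔭
  · subst h; simp only [h𝔭, ne_eq, Nat.cast_eq_zero, hn.ne', not_false_eq_true]
  · simp only [h𝔮 𝔮 h, ne_eq, not_true_eq_false, h]

/-- The support of `gen 𝔭` is `{𝔭}`. [cite: MochizukiEtTh2009, Prop 5.3 p.325 (PDF p.99)] -/
theorem supp_gen (𝔭 : Primes 𝔉.PhiAcirc) : 𝔖.supp (Algebra.GrothendieckGroup.of (𝔖.gen 𝔭)) = {𝔭} :=
  𝔖.supp_of_mem_carrier ((𝔖.mem_carrier_iff 𝔭 _).mpr ⟨1, one_pos, (pow_one _).symm⟩)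

/-- Coprimality: `supp y ⊆ supp (y · x⁻¹)` when `x, y` have disjoint supports (so finiteness descends to `y`).
[cite: MochizukiEtTh2009, Prop 5.3 proof p.326 (PDF p.100)] -/
theorem supp_subset_of_coprime {x y : Algebra.GrothendieckGroup 𝔉.PhiAcirc} (h : CoprimeOf' 𝔖.factor x y) :
    𝔖.supp y ⊆ 𝔖.supp (y * x⁻¹) := by
  intro 𝔭 h𝔭
  have hx : 𝔭 ∉ 𝔖.supp x := fun h' => Set.disjoint_left.mp h h' h𝔭
  rw [𝔖.mem_supp_iff] at h𝔭 ⊢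
  rwa [ord_mul, ord_inv, 𝔖.ord_eq_zero_of_notMem_supp hx, neg_zero, add_zero]

/-- A cuspidal element has order `0` at every non-cuspidal prime.
[cite: MochizukiEtTh2009, Prop 5.3 proof p.326 (PDF p.100)] -/
theorem ord_eq_zero_of_isCuspidalGp {x : Algebra.GrothendieckGroup 𝔉.PhiAcirc} (hx : 𝔖.IsCuspidalGp x)
    {𝔫 : Primes 𝔉.PhiAcirc} (h𝔫 : ¬ 𝔓.IsCuspidal 𝔫) : 𝔖.ord 𝔫 x = 0 :=
  𝔖.ord_eq_zero_of_notMem_supp fun h => h𝔫 (hx 𝔫 h)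

/-! ### The two halves of the degree: vertical part and cusp sum -/

/-- `degOn` = vertical part + cusp sum, the cusp sum written as a `finsum` over the fibre TYPE.
[cite: MochizukiEtTh2009, §1 p.240 (PDF p.14)] -/
theorem degOn_eq (𝔫 : {p : Primes 𝔉.PhiAcirc // ¬ 𝔓.IsCuspidal p}) (x : Algebra.GrothendieckGroup 𝔉.PhiAcirc) :
    𝔖.degOn 𝔫 x = (𝔖.ord (ncspShift 𝔓 (-1) 𝔫).1 x - 2 * 𝔖.ord 𝔫.1 x + 𝔖.ord (ncspShift 𝔓 1 𝔫).1 x) +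
      ∑ᶠ 𝔠 : {𝔠 : {p : Primes 𝔉.PhiAcirc // 𝔓.IsCuspidal p} // 𝔓.cspToNcsp 𝔠 = 𝔫}, 𝔖.ord 𝔠.1.1 x := by
  rw [degOn, ← finsum_set_coe_eq_finsum_mem]
  rfl

/-- The vertical part is additive. [cite: MochizukiEtTh2009, §1 p.240 (PDF p.14)] -/
theorem vert_mul (𝔫 : {p : Primes 𝔉.PhiAcirc // ¬ 𝔓.IsCuspidal p}) (x y : Algebra.GrothendieckGroup 𝔉.PhiAcirc) :
    𝔖.ord (ncspShift 𝔓 (-1) 𝔫).1 (x * y) - 2 * 𝔖.ord 𝔫.1 (x * y) + 𝔖.ord (ncspShift 𝔓 1 𝔫).1 (x * y) =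
      (𝔖.ord (ncspShift 𝔓 (-1) 𝔫).1 x - 2 * 𝔖.ord 𝔫.1 x + 𝔖.ord (ncspShift 𝔓 1 𝔫).1 x) +
        (𝔖.ord (ncspShift 𝔓 (-1) 𝔫).1 y - 2 * 𝔖.ord 𝔫.1 y + 𝔖.ord (ncspShift 𝔓 1 𝔫).1 y) := by
  simp only [ord_mul]; ring

/-- The vertical part of an inverse. [cite: MochizukiEtTh2009, §1 p.240 (PDF p.14)] -/
theorem vert_inv (𝔫 : {p : Primes 𝔉.PhiAcirc // ¬ 𝔓.IsCuspidal p}) (x : Algebra.GrothendieckGroup 𝔉.PhiAcirc) :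
    𝔖.ord (ncspShift 𝔓 (-1) 𝔫).1 x⁻¹ - 2 * 𝔖.ord 𝔫.1 x⁻¹ + 𝔖.ord (ncspShift 𝔓 1 𝔫).1 x⁻¹ =
      -(𝔖.ord (ncspShift 𝔓 (-1) 𝔫).1 x - 2 * 𝔖.ord 𝔫.1 x + 𝔖.ord (ncspShift 𝔓 1 𝔫).1 x) := by
  simp only [ord_inv]; ring

/-- The vertical part vanishes on cuspidal elements.
[cite: MochizukiEtTh2009, Prop 5.3 proof p.326 (PDF p.100)] -/
theorem vert_eq_zero_of_isCuspidalGp (𝔫 : {p : Primes 𝔉.PhiAcirc // ¬ 𝔓.IsCuspidal p})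
    {x : Algebra.GrothendieckGroup 𝔉.PhiAcirc} (hx : 𝔖.IsCuspidalGp x) :
    𝔖.ord (ncspShift 𝔓 (-1) 𝔫).1 x - 2 * 𝔖.ord 𝔫.1 x + 𝔖.ord (ncspShift 𝔓 1 𝔫).1 x = 0 := by
  rw [𝔖.ord_eq_zero_of_isCuspidalGp hx (ncspShift 𝔓 (-1) 𝔫).2, 𝔖.ord_eq_zero_of_isCuspidalGp hx 𝔫.2,
    𝔖.ord_eq_zero_of_isCuspidalGp hx (ncspShift 𝔓 1 𝔫).2]
  ring

/-- The cusp-order function of an element of finite support has finite support.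
[cite: MochizukiEtTh2009, Prop 5.3 proof p.326 (PDF p.100)] -/
theorem hasFiniteSupport_cuspOrd (𝔫 : {p : Primes 𝔉.PhiAcirc // ¬ 𝔓.IsCuspidal p})
    {x : Algebra.GrothendieckGroup 𝔉.PhiAcirc} (hx : (𝔖.supp x).Finite) :
    (Function.support fun 𝔠 : {𝔠 : {p : Primes 𝔉.PhiAcirc // 𝔓.IsCuspidal p} // 𝔓.cspToNcsp 𝔠 = 𝔫} =>
      𝔖.ord 𝔠.1.1 x).Finite := by
  apply (hx.preimage
    (f := fun 𝔠 : {𝔠 : {p : Primes 𝔉.PhiAcirc // 𝔓.IsCuspidal p} // 𝔓.cspToNcsp 𝔠 = 𝔫} => 𝔠.1.1)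
    (Set.injOn_of_injective fun a b h => Subtype.ext (Subtype.ext h))).subset
  intro 𝔠 h𝔠
  exact (𝔖.mem_supp_iff _ _).mpr h𝔠

/-- The cusp sum is additive on elements of finite support. [cite: MochizukiEtTh2009, §1 p.240 (PDF p.14)] -/
theorem cuspSum_mul (𝔫 : {p : Primes 𝔉.PhiAcirc // ¬ 𝔓.IsCuspidal p})
    {x y : Algebra.GrothendieckGroup 𝔉.PhiAcirc} (hx : (𝔖.supp x).Finite) (hy : (𝔖.supp y).Finite) :
    ∑ᶠ 𝔠 : {𝔠 : {p : Primes 𝔉.PhiAcirc // 𝔓.IsCuspidal p} // 𝔓.cspToNcsp 𝔠 = 𝔫}, 𝔖.ord 𝔠.1.1 (x * y) =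
      (∑ᶠ 𝔠 : {𝔠 : {p : Primes 𝔉.PhiAcirc // 𝔓.IsCuspidal p} // 𝔓.cspToNcsp 𝔠 = 𝔫}, 𝔖.ord 𝔠.1.1 x) +
        ∑ᶠ 𝔠 : {𝔠 : {p : Primes 𝔉.PhiAcirc // 𝔓.IsCuspidal p} // 𝔓.cspToNcsp 𝔠 = 𝔫}, 𝔖.ord 𝔠.1.1 y := by
  simp only [ord_mul]
  exact finsum_add_distrib (𝔖.hasFiniteSupport_cuspOrd 𝔫 hx) (𝔖.hasFiniteSupport_cuspOrd 𝔫 hy)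

/-- The cusp sum of an inverse. [cite: MochizukiEtTh2009, §1 p.240 (PDF p.14)] -/
theorem cuspSum_inv (𝔫 : {p : Primes 𝔉.PhiAcirc // ¬ 𝔓.IsCuspidal p}) (x : Algebra.GrothendieckGroup 𝔉.PhiAcirc) :
    ∑ᶠ 𝔠 : {𝔠 : {p : Primes 𝔉.PhiAcirc // 𝔓.IsCuspidal p} // 𝔓.cspToNcsp 𝔠 = 𝔫}, 𝔖.ord 𝔠.1.1 x⁻¹ =
      -∑ᶠ 𝔠 : {𝔠 : {p : Primes 𝔉.PhiAcirc // 𝔓.IsCuspidal p} // 𝔓.cspToNcsp 𝔠 = 𝔫}, 𝔖.ord 𝔠.1.1 x := by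
  simp only [ord_inv]
  exact finsum_neg_distrib _

/-- `degOn` is additive on elements of finite support. [cite: MochizukiEtTh2009, §1 p.240 (PDF p.14)] -/
theorem degOn_mul (𝔫 : {p : Primes 𝔉.PhiAcirc // ¬ 𝔓.IsCuspidal p})
    {x y : Algebra.GrothendieckGroup 𝔉.PhiAcirc} (hx : (𝔖.supp x).Finite) (hy : (𝔖.supp y).Finite) :
    𝔖.degOn 𝔫 (x * y) = 𝔖.degOn 𝔫 x + 𝔖.degOn 𝔫 y := by
  rw [degOn_eq, degOn_eq, degOn_eq, vert_mul, 𝔖.cuspSum_mul 𝔫 hx hy]; ring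

/-- `degOn` of an inverse. [cite: MochizukiEtTh2009, §1 p.240 (PDF p.14)] -/
theorem degOn_inv (𝔫 : {p : Primes 𝔉.PhiAcirc // ¬ 𝔓.IsCuspidal p}) (x : Algebra.GrothendieckGroup 𝔉.PhiAcirc) :
    𝔖.degOn 𝔫 x⁻¹ = -𝔖.degOn 𝔫 x := by
  rw [degOn_eq, degOn_eq, vert_inv, cuspSum_inv]; ring

/-- The cusp sum of an element of `Φ(A_⊚)` is non-negative (no finiteness needed).
[cite: MochizukiEtTh2009, Prop 5.3 proof p.326 (PDF p.100)] -/
theorem cuspSum_of_nonneg (𝔫 : {p : Primes 𝔉.PhiAcirc // ¬ 𝔓.IsCuspidal p}) (b : 𝔉.PhiAcirc) :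
    0 ≤ ∑ᶠ 𝔠 : {𝔠 : {p : Primes 𝔉.PhiAcirc // 𝔓.IsCuspidal p} // 𝔓.cspToNcsp 𝔠 = 𝔫},
      𝔖.ord 𝔠.1.1 (Algebra.GrothendieckGroup.of b) :=
  finsum_nonneg fun _ => 𝔖.ord_of_nonneg _ _

/-- The cusp sum on `𝔫` of an element with a single CUSPIDAL coordinate `m` at `𝔞`: `m` if `𝔞 ↦ 𝔫`, else `0`.
[cite: MochizukiEtTh2009, Prop 5.3 proof p.326 (PDF p.100)] -/
theorem cuspSum_of_cusp (𝔫 : {p : Primes 𝔉.PhiAcirc // ¬ 𝔓.IsCuspidal p}) {𝔞 : Primes 𝔉.PhiAcirc}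
    (h𝔞 : 𝔓.IsCuspidal 𝔞) {x : Algebra.GrothendieckGroup 𝔉.PhiAcirc} {m : ℚ} (h𝔞x : 𝔖.ord 𝔞 x = m)
    (hx : ∀ 𝔮, 𝔮 ≠ 𝔞 → 𝔖.ord 𝔮 x = 0) :
    ∑ᶠ 𝔠 : {𝔠 : {p : Primes 𝔉.PhiAcirc // 𝔓.IsCuspidal p} // 𝔓.cspToNcsp 𝔠 = 𝔫}, 𝔖.ord 𝔠.1.1 x =
      if 𝔓.cspToNcsp ⟨𝔞, h𝔞⟩ = 𝔫 then m else 0 := by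
  split_ifs with h
  · rw [finsum_eq_single _
      (⟨⟨𝔞, h𝔞⟩, h⟩ : {𝔠 : {p : Primes 𝔉.PhiAcirc // 𝔓.IsCuspidal p} // 𝔓.cspToNcsp 𝔠 = 𝔫})]
    · exact h𝔞x
    · intro 𝔠 h𝔠
      exact hx _ fun h' => h𝔠 (Subtype.ext (Subtype.ext h'))
  · apply finsum_eq_zero_of_forall_eq_zero
    intro 𝔠
    apply hx
    intro h'
    apply h
    have : 𝔠.1 = ⟨𝔞, h𝔞⟩ := Subtype.ext h'
    rw [← this]; exact 𝔠.2

/-- The cusp sum vanishes on an element with no cuspidal prime in its support (e.g. one supported on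
components).  [cite: MochizukiEtTh2009, Prop 5.3 proof p.326 (PDF p.100)] -/
theorem cuspSum_eq_zero_of_forall (𝔫 : {p : Primes 𝔉.PhiAcirc // ¬ 𝔓.IsCuspidal p})
    {x : Algebra.GrothendieckGroup 𝔉.PhiAcirc}
    (hx : ∀ 𝔠 : Primes 𝔉.PhiAcirc, 𝔓.IsCuspidal 𝔠 → 𝔖.ord 𝔠 x = 0) :
    ∑ᶠ 𝔠 : {𝔠 : {p : Primes 𝔉.PhiAcirc // 𝔓.IsCuspidal p} // 𝔓.cspToNcsp 𝔠 = 𝔫}, 𝔖.ord 𝔠.1.1 x = 0 :=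
  finsum_eq_zero_of_forall_eq_zero fun 𝔠 => hx _ 𝔠.1.2

/-- The vertical part on `𝔫` of an element `x` with a single coordinate `k` at `𝔫₀` (and `0` at every other
prime): `k·([𝔫⁻ = 𝔫₀] − 2[𝔫 = 𝔫₀] + [𝔫⁺ = 𝔫₀])`. [cite: MochizukiEtTh2009, §1 p.240 (PDF p.14)] -/
theorem vert_of_single (𝔫 : {p : Primes 𝔉.PhiAcirc // ¬ 𝔓.IsCuspidal p}) {𝔫₀ : Primes 𝔉.PhiAcirc}
    {x : Algebra.GrothendieckGroup 𝔉.PhiAcirc} {k : ℚ} (h₀ : 𝔖.ord 𝔫₀ x = k)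
    (hx : ∀ 𝔮, 𝔮 ≠ 𝔫₀ → 𝔖.ord 𝔮 x = 0) :
    𝔖.ord (ncspShift 𝔓 (-1) 𝔫).1 x - 2 * 𝔖.ord 𝔫.1 x + 𝔖.ord (ncspShift 𝔓 1 𝔫).1 x =
      k * ((if (ncspShift 𝔓 (-1) 𝔫).1 = 𝔫₀ then 1 else 0) - 2 * (if 𝔫.1 = 𝔫₀ then 1 else 0) +
        (if (ncspShift 𝔓 1 𝔫).1 = 𝔫₀ then 1 else 0)) := by
  have hval : ∀ 𝔮 : Primes 𝔉.PhiAcirc, 𝔖.ord 𝔮 x = k * (if 𝔮 = 𝔫₀ then 1 else 0) := by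
    intro 𝔮; split_ifs with h
    · rw [h, h₀, mul_one]
    · rw [hx 𝔮 h, mul_zero]
  simp only [hval]; ring

end DivisorSupportData'

end FrobenioidThetaDivisors

end Literature.AnabelianGeometry.EtaleTheta
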